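import Summits.ABC.StewartYu.MatveevLever
import Mathlib.Analysis.Matrix.Order
import Mathlib.MeasureTheory.Measure.Lebesgue.VolumeOfBalls
import Mathlib.MeasureTheory.Measure.Lebesgue.EqHaar
import HarnessLib

/-!
# The Matveev–Nesterenko lever, volume side: Nesterenko 2003, (5.19)–(5.21)

Cell topic `Summits/ABC/StewartYu` (cell abc-stewartyu, seat p4); namespace
`Summit.ABC.StewartYu.MatveevLever` (theorems only). Sequel of `MatveevLever.lean`: there the
lever `exists_short_relation` bounds `∏ᵢ ‖zᵢ‖_A` by `2^ν / vol(𝔎_a)` with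
`𝔎_a = {y ∈ ℝ^ν ; ‖∑ yᵢ aᵢ‖_A < 1}` (`= V(Φ)/V(𝔎)` in the coordinates of the basis `a` of `Φ`).
The end of the zero-estimate argument (Nesterenko 2003, §5.2, (5.19)–(5.22)) needs this volume
bounded BELOW by the minors sum `∑_{|I|=ν} |det a_I| ∏_{i∈I} Aᵢ` of the basis matrix — the
quantity the zero estimate (Prop. 5.1, `𝓗(T_Φ; D)`) controls. PROVED here, exactly as printed:

* `sq_sum_abs_le` — Cauchy–Schwarz `(∑ⱼ |wⱼ|)² ≤ n ∑ⱼ wⱼ²`, i.e. the ball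
  `𝔎₁ = {∑ Aⱼ² xⱼ² < 1/n}` lies inside `𝔎 = {∑ Aⱼ|xⱼ| < 1}` ((5.19));
* `volume_weightedBall_ge` — (5.19)–(5.21):
  `vol(𝔎_a) ≥ (√π^ν / Γ(ν/2+1)) / (√n^ν · ∑_t |det a_t| ∏_k A_{t k})`, the sum over the strictly
  increasing `t : Fin ν → Fin n` (= the `ν`-subsets `I`): the inscribed ellipsoid
  `{y ; n·yᵀ(C Cᵀ)y < 1}`, `C = (aᵢⱼ Aⱼ)`, has volume `ω_ν n^{−ν/2} / √det(C Cᵀ)` (a square root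
  `Bᵀ B = C Cᵀ` from the positive-semidefinite functional calculus, then
  `MeasureTheory.Measure.addHaar_preimage_linearMap` and `MeasureTheory.volume_sum_rpow_lt`), and
  Cauchy–Binet (`Literature.Analysis.TotalPositivity.det_mul_eq_sum_strictMono`) gives
  `det(C Cᵀ) = ∑_t det(C_t)² ≤ (∑_t |det C_t|)²`, `det C_t = det a_t · ∏_k A_{t k}` ((5.21):
  "`V(Ψ) = (∑ …²)^{1/2} ≤ ∑_I |det M_I| A_I`");
* `exists_short_relation_minors` — the lever in the form the induction consumes:
  `∏ᵢ ‖zᵢ‖_A ≤ 2^ν · Γ(ν/2+1) · √π^{−ν} · √n^{ν} · ∑_t |det a_t| ∏_k A_{t k}` together with the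
  relation `m₀ b = ∑ mᵢ zᵢ` and the bounds (2.11)/(2.12) of `exists_short_relation`.

WHAT THIS IS NOT: no zero estimate (WP-M3.Z, `Nesterenko2003_prop51`), no parameter choice
(5.22), no linear forms.

## References

* [Nesterenko2003] Yu. V. Nesterenko, *Linear forms in logarithms of rational numbers*, in:
  Diophantine Approximation (Cetraro 2000), LNM 1819, Springer 2003, 53–106: §5.2, (5.19)–(5.21),
  p. 103; Prop. 2.6, (2.8), (2.13), pp. 57–58.
-/

noncomputable section

namespace Summit.ABC.StewartYu.MatveevLever

open Matrix Finset MeasureTheory Module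
open scoped MatrixOrder ComplexOrder

/-! ### Cauchy–Schwarz -/

/-- `(∑ⱼ |wⱼ|)² ≤ n · ∑ⱼ wⱼ²` (Cauchy–Schwarz; Nesterenko's `𝔎₁ ⊂ 𝔎`).
[cite: Nesterenko2003, §5.2 (5.19), p. 103] -/
theorem sq_sum_abs_le {n : ℕ} (w : Fin n → ℝ) : (∑ j, |w j|) ^ 2 ≤ n * ∑ j, w j ^ 2 := by
  have h := Finset.sum_mul_sq_le_sq_mul_sq (univ : Finset (Fin n)) (fun _ => (1 : ℝ)) (fun j => |w j|)
  simpa [sq_abs] using h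

/-! ### A real Gram determinant -/

/-- If `y ↦ y C` is injective then `det(C Cᵀ) ≠ 0` (real version of
`det_mul_transpose_self_ne_zero`). [folklore] -/
theorem det_mul_transpose_self_ne_zero_real {ν n : ℕ} (C : Matrix (Fin ν) (Fin n) ℝ)
    (hC : ∀ y : Fin ν → ℝ, y ᵥ* C = 0 → y = 0) : (C * Cᵀ).det ≠ 0 := by
  classical
  intro hdet
  obtain ⟨v, hv0, hv⟩ := Matrix.exists_mulVec_eq_zero_iff.mpr hdet
  have h1 : (v ᵥ* C) ⬝ᵥ (v ᵥ* C) = 0 := by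
    calc (v ᵥ* C) ⬝ᵥ (v ᵥ* C) = (v ᵥ* C) ⬝ᵥ (Cᵀ *ᵥ v) := by rw [Matrix.mulVec_transpose]
      _ = v ⬝ᵥ (C *ᵥ (Cᵀ *ᵥ v)) := (Matrix.dotProduct_mulVec v C _).symm
      _ = 0 := by rw [Matrix.mulVec_mulVec, hv, dotProduct_zero]
  exact hv0 (hC v (dotProduct_self_eq_zero.mp h1))

/-! ### (5.19)–(5.21): the volume of `𝔎_a` against the minors sum -/

open scoped Classical in
/-- **Nesterenko 2003, (5.19)–(5.21).** For weights `Aⱼ > 0` and a `ℤ`-independent family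
`a₁, …, a_ν ∈ ℤⁿ` (`ν ≥ 1`), the body `𝔎_a = {y ∈ ℝ^ν ; ∑ⱼ Aⱼ |∑ᵢ yᵢ aᵢⱼ| < 1}` satisfies
`vol(𝔎_a) ≥ (√π^ν / Γ(ν/2+1)) / (√n^ν · ∑_t |det (aᵢ,t(k))| · ∏_k A_{t(k)})`, the sum over
strictly increasing `t : Fin ν → Fin n`. Printed form: `V(Φ)/V(𝔎) ≤ Γ(1+r/2) π^{−r/2} n^{r/2} V(Ψ)`
with `V(Ψ) = (∑_I (det M_I A_I)²)^{1/2} ≤ ∑_I |det M_I| A_I`.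
[cite: Nesterenko2003, §5.2 (5.19)–(5.21), p. 103] -/
theorem volume_weightedBall_ge {n ν : ℕ} (hν : 0 < ν) (A : Fin n → ℝ) (hA : ∀ j, 0 < A j)
    (a : Fin ν → (Fin n → ℤ)) (ha : LinearIndependent ℤ a) :
    ENNReal.ofReal ((Real.sqrt Real.pi ^ ν / Real.Gamma ((ν : ℝ) / 2 + 1)) /
        (Real.sqrt n ^ ν *
          ∑ t ∈ (univ : Finset (Fin ν → Fin n)).filter (fun t => StrictMono t),
            |(Matrix.of fun i k => (a i (t k) : ℝ)).det| * ∏ k, A (t k))) ≤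
      volume {y : Fin ν → ℝ | ∑ j, A j * |∑ i, y i * (a i j : ℝ)| < 1} := by
  haveI : Nonempty (Fin ν) := ⟨⟨0, hν⟩⟩
  have hn : 0 < n := by
    -- `ν ≥ 1` independent vectors in `ℤⁿ` force `n ≥ 1`
    rcases Nat.eq_zero_or_pos n with h0 | h0
    · subst h0
      exfalso
      have hz : a ⟨0, hν⟩ = 0 := funext fun j => Fin.elim0 j
      exact ha.ne_zero ⟨0, hν⟩ hz
    · exact h0
  -- the matrices
  set aℝ : Matrix (Fin ν) (Fin n) ℝ := (Matrix.of a).map (Int.castRingHom ℝ) with haℝ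
  have haℝ_apply : ∀ i j, aℝ i j = (a i j : ℝ) := fun i j => by simp [haℝ]
  set C : Matrix (Fin ν) (Fin n) ℝ := Matrix.of fun i j => (a i j : ℝ) * A j with hCdef
  have hC_eq : C = aℝ * Matrix.diagonal A := by
    ext i j; simp [hCdef, haℝ_apply, Matrix.mul_diagonal]
  have hvecC : ∀ y : Fin ν → ℝ, ∀ j, (y ᵥ* C) j = A j * ∑ i, y i * (a i j : ℝ) := fun y j => by
    simp only [Matrix.vecMul, dotProduct, hCdef, Matrix.of_apply, Finset.mul_sum]
    exact Finset.sum_congr rfl fun i _ => by ring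
  -- injectivity of `y ↦ y aℝ` (integer Gram determinant) and of `y ↦ y C`
  have hGramℤ : (Matrix.of a * (Matrix.of a)ᵀ).det ≠ 0 :=
    det_mul_transpose_self_ne_zero (Matrix.of a) (by exact ha)
  have hGramℝ : (aℝ * aℝᵀ).det ≠ 0 := by
    rw [haℝ, ← Matrix.transpose_map, ← Matrix.map_mul, det_map_castRingHom]
    exact_mod_cast hGramℤ
  have hinjA : ∀ y : Fin ν → ℝ, y ᵥ* aℝ = 0 → y = 0 := fun y hy => by
    have h3 : y ᵥ* (aℝ * aℝᵀ) = 0 := by rw [← Matrix.vecMul_vecMul, hy, Matrix.zero_vecMul]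
    exact Matrix.eq_zero_of_vecMul_eq_zero hGramℝ h3
  have hinjC : ∀ y : Fin ν → ℝ, y ᵥ* C = 0 → y = 0 := fun y hy => by
    refine hinjA y (funext fun j => ?_)
    have h := congrFun hy j
    rw [hC_eq, ← Matrix.vecMul_vecMul, Matrix.vecMul_diagonal] at h
    simpa [(hA j).ne'] using h
  -- the Gram matrix `G = C Cᵀ` and a square root `Bᵀ B = G`
  set G : Matrix (Fin ν) (Fin ν) ℝ := C * Cᵀ with hG
  have hGdet : G.det ≠ 0 := det_mul_transpose_self_ne_zero_real C hinjC
  have hGpsd : G.PosSemidef := by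
    rw [hG, ← Matrix.conjTranspose_eq_transpose_of_trivial]
    exact Matrix.posSemidef_self_mul_conjTranspose C
  obtain ⟨B, hB⟩ : ∃ B : Matrix (Fin ν) (Fin ν) ℝ, G = Bᵀ * B := by
    obtain ⟨B, hB⟩ := CStarAlgebra.nonneg_iff_eq_star_mul_self.mp hGpsd.nonneg
    exact ⟨B, by rw [hB, Matrix.star_eq_conjTranspose, Matrix.conjTranspose_eq_transpose_of_trivial]⟩
  have hBdet_sq : B.det ^ 2 = G.det := by
    rw [hB, Matrix.det_mul, Matrix.det_transpose, sq]
  have hBdet : B.det ≠ 0 := fun h => hGdet (by rw [← hBdet_sq, h]; ring)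
  -- Cauchy–Binet: `det G = ∑_t det(C_t)²`, `det C_t = det a_t · ∏ A (t k)`
  set M : ℝ := ∑ t ∈ (univ : Finset (Fin ν → Fin n)).filter (fun t => StrictMono t),
      |(Matrix.of fun i k => (a i (t k) : ℝ)).det| * ∏ k, A (t k) with hM
  have hCt : ∀ t : Fin ν → Fin n, (C.submatrix id t).det =
      (Matrix.of fun i k => (a i (t k) : ℝ)).det * ∏ k, A (t k) := fun t => by
    have h1 : C.submatrix id t = (Matrix.of fun i k => (a i (t k) : ℝ)) * Matrix.diagonal (fun k => A (t k)) := by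
      ext i k; simp [hCdef, Matrix.mul_diagonal]
    rw [h1, Matrix.det_mul, Matrix.det_diagonal]
  have hGsum : G.det = ∑ t ∈ (univ : Finset (Fin ν → Fin n)).filter (fun t => StrictMono t),
      ((Matrix.of fun i k => (a i (t k) : ℝ)).det * ∏ k, A (t k)) ^ 2 := by
    rw [hG, Literature.Analysis.TotalPositivity.det_mul_eq_sum_strictMono]
    refine Finset.sum_congr rfl fun t _ => ?_
    rw [← Matrix.transpose_submatrix, Matrix.det_transpose, hCt, sq]
  have hterm_nonneg : ∀ t : Fin ν → Fin n,
      0 ≤ |(Matrix.of fun i k => (a i (t k) : ℝ)).det| * ∏ k, A (t k) := fun t =>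
    mul_nonneg (abs_nonneg _) (Finset.prod_nonneg fun k _ => (hA _).le)
  have hM_nonneg : 0 ≤ M := Finset.sum_nonneg fun t _ => hterm_nonneg t
  have habsB : |B.det| ≤ M := by
    have h1 : |B.det| ^ 2 ≤ M ^ 2 := by
      rw [sq_abs, hBdet_sq, hGsum, hM]
      calc ∑ t ∈ univ.filter (fun t => StrictMono t),
            ((Matrix.of fun i k => (a i (t k) : ℝ)).det * ∏ k, A (t k)) ^ 2
          = ∑ t ∈ univ.filter (fun t => StrictMono t),
            (|(Matrix.of fun i k => (a i (t k) : ℝ)).det| * ∏ k, A (t k)) ^ 2 := by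
            refine Finset.sum_congr rfl fun t _ => ?_
            rw [mul_pow, mul_pow, sq_abs]
        _ ≤ _ := Finset.sum_sq_le_sq_sum_of_nonneg fun t _ => hterm_nonneg t
    exact (pow_le_pow_iff_left₀ (abs_nonneg _) hM_nonneg two_ne_zero).mp h1
  have hMpos : 0 < M := lt_of_lt_of_le (abs_pos.mpr hBdet) habsB
  -- the inscribed ellipsoid `E = B⁻¹(ball of radius 1/√n)`
  set r : ℝ := (Real.sqrt n)⁻¹ with hr
  have hrpos : 0 < r := by
    rw [hr]; exact inv_pos.mpr (Real.sqrt_pos.mpr (by exact_mod_cast hn))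
  set Ball : Set (Fin ν → ℝ) := {w : Fin ν → ℝ | (∑ k, |w k| ^ (2 : ℝ)) ^ (1 / (2 : ℝ)) < r} with hBall
  set S : Set (Fin ν → ℝ) := {y : Fin ν → ℝ | ∑ j, A j * |∑ i, y i * (a i j : ℝ)| < 1} with hS
  have hsub : (Matrix.toLin' B) ⁻¹' Ball ⊆ S := by
    intro y hy
    rw [Set.mem_preimage, hBall, Set.mem_setOf_eq, Matrix.toLin'_apply] at hy
    rw [hS, Set.mem_setOf_eq]
    -- `∑ (B y)_k² < 1/n`
    have hsq : ∑ k, (B *ᵥ y) k ^ 2 < r ^ 2 := by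
      have h0 : 0 ≤ ∑ k, |(B *ᵥ y) k| ^ (2 : ℝ) := Finset.sum_nonneg fun k _ => by positivity
      have h1 : (∑ k, |(B *ᵥ y) k| ^ (2 : ℝ)) < r ^ 2 := by
        have h2 := hy
        rw [← Real.sqrt_eq_rpow] at h2
        exact (Real.sqrt_lt' hrpos).mp h2
      have h3 : ∑ k, |(B *ᵥ y) k| ^ (2 : ℝ) = ∑ k, (B *ᵥ y) k ^ 2 :=
        Finset.sum_congr rfl fun k _ => by rw [Real.rpow_two, sq_abs]
      rw [h3] at h1; exact h1
    have hr2 : r ^ 2 = (n : ℝ)⁻¹ := by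
      rw [hr, inv_pow, Real.sq_sqrt (by positivity)]
    -- `∑ (B y)_k² = ∑ (y C)_j²`
    have hquad : ∑ k, (B *ᵥ y) k ^ 2 = ∑ j, (y ᵥ* C) j ^ 2 := by
      have h1 : ∑ k, (B *ᵥ y) k ^ 2 = (B *ᵥ y) ⬝ᵥ (B *ᵥ y) := by
        simp [dotProduct, sq]
      have h2 : ∑ j, (y ᵥ* C) j ^ 2 = (y ᵥ* C) ⬝ᵥ (y ᵥ* C) := by
        simp [dotProduct, sq]
      rw [h1, h2]
      calc (B *ᵥ y) ⬝ᵥ (B *ᵥ y) = (y ᵥ* Bᵀ) ⬝ᵥ (B *ᵥ y) := by rw [Matrix.vecMul_transpose]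
        _ = y ⬝ᵥ (Bᵀ *ᵥ (B *ᵥ y)) := (Matrix.dotProduct_mulVec y Bᵀ _).symm
        _ = y ⬝ᵥ (G *ᵥ y) := by rw [Matrix.mulVec_mulVec, hB]
        _ = y ⬝ᵥ (C *ᵥ (Cᵀ *ᵥ y)) := by rw [hG, Matrix.mulVec_mulVec]
        _ = (y ᵥ* C) ⬝ᵥ (Cᵀ *ᵥ y) := Matrix.dotProduct_mulVec y C _
        _ = (y ᵥ* C) ⬝ᵥ (y ᵥ* C) := by rw [Matrix.mulVec_transpose]
    -- Cauchy–Schwarz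
    have hcs := sq_sum_abs_le (fun j => (y ᵥ* C) j)
    have hlt : (∑ j, |(y ᵥ* C) j|) ^ 2 < 1 := by
      refine lt_of_le_of_lt hcs ?_
      rw [← hquad]
      calc (n : ℝ) * ∑ k, (B *ᵥ y) k ^ 2 < n * r ^ 2 :=
            mul_lt_mul_of_pos_left hsq (by exact_mod_cast hn)
        _ = 1 := by rw [hr2, mul_inv_cancel₀ (by exact_mod_cast hn.ne')]
    have hsum_nonneg : 0 ≤ ∑ j, |(y ᵥ* C) j| := Finset.sum_nonneg fun j _ => abs_nonneg _
    have hlt1 : ∑ j, |(y ᵥ* C) j| < 1 := by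
      by_contra hge
      rw [not_lt] at hge
      have : (1 : ℝ) ≤ (∑ j, |(y ᵥ* C) j|) ^ 2 := by
        simpa using pow_le_pow_left₀ zero_le_one hge 2
      linarith
    calc ∑ j, A j * |∑ i, y i * (a i j : ℝ)| = ∑ j, |(y ᵥ* C) j| := by
          refine Finset.sum_congr rfl fun j _ => ?_
          rw [hvecC, abs_mul, abs_of_pos (hA j)]
      _ < 1 := hlt1
  -- volume of the ellipsoid
  have hvolBall : volume Ball = (ENNReal.ofReal r) ^ ν *
      ENNReal.ofReal (Real.sqrt Real.pi ^ ν / Real.Gamma ((ν : ℝ) / 2 + 1)) := by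
    have h := MeasureTheory.volume_sum_rpow_lt (Fin ν) (p := (2 : ℝ)) (by norm_num) r
    have hg : 2 * Real.Gamma (1 / (2 : ℝ) + 1) = Real.sqrt Real.pi := by
      rw [Real.Gamma_add_one (by norm_num), Real.Gamma_one_half_eq]; ring
    rw [hBall, h, Fintype.card_fin, hg]
  have hvolE : volume ((Matrix.toLin' B) ⁻¹' Ball) =
      ENNReal.ofReal |(B.det)⁻¹| * volume Ball := by
    have h := MeasureTheory.Measure.addHaar_preimage_linearMap (μ := volume)
      (f := Matrix.toLin' B) (by rw [LinearMap.det_toLin']; exact hBdet) Ball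
    rw [LinearMap.det_toLin'] at h
    exact h
  -- assemble
  calc ENNReal.ofReal ((Real.sqrt Real.pi ^ ν / Real.Gamma ((ν : ℝ) / 2 + 1)) / (Real.sqrt n ^ ν * M))
      ≤ ENNReal.ofReal |(B.det)⁻¹| * ((ENNReal.ofReal r) ^ ν *
          ENNReal.ofReal (Real.sqrt Real.pi ^ ν / Real.Gamma ((ν : ℝ) / 2 + 1))) := by
        rw [← ENNReal.ofReal_pow hrpos.le, ← ENNReal.ofReal_mul (pow_nonneg hrpos.le _),
          ← ENNReal.ofReal_mul (abs_nonneg _)]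
        refine ENNReal.ofReal_le_ofReal ?_
        have hω : 0 ≤ Real.sqrt Real.pi ^ ν / Real.Gamma ((ν : ℝ) / 2 + 1) :=
          div_nonneg (pow_nonneg (Real.sqrt_nonneg _) _) (Real.Gamma_pos_of_pos (by positivity)).le
        have hsn : 0 < Real.sqrt n ^ ν := pow_pos (Real.sqrt_pos.mpr (by exact_mod_cast hn)) _
        rw [div_eq_mul_inv, mul_inv, mul_comm, hr, inv_pow]
        -- goal: ((√n^ν)⁻¹ * M⁻¹) * ω ≤ |det B|⁻¹ * ((√n ^ ν)⁻¹ * ω)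
        have h1 : M⁻¹ ≤ |(B.det)⁻¹| := by
          rw [abs_inv]; exact inv_anti₀ (abs_pos.mpr hBdet) habsB
        calc (Real.sqrt n ^ ν)⁻¹ * M⁻¹ * (Real.sqrt Real.pi ^ ν / Real.Gamma ((ν : ℝ) / 2 + 1))
            = M⁻¹ * ((Real.sqrt n ^ ν)⁻¹ * (Real.sqrt Real.pi ^ ν / Real.Gamma ((ν : ℝ) / 2 + 1))) := by
              ring
          _ ≤ |(B.det)⁻¹| * ((Real.sqrt n ^ ν)⁻¹ * (Real.sqrt Real.pi ^ ν / Real.Gamma ((ν : ℝ) / 2 + 1))) :=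
              mul_le_mul_of_nonneg_right h1 (mul_nonneg (inv_nonneg.mpr hsn.le) hω)
    _ = volume ((Matrix.toLin' B) ⁻¹' Ball) := by rw [hvolE, hvolBall]
    _ ≤ volume S := measure_mono hsub

/-! ### Positivity of the minors sum -/

open scoped Classical in
/-- For a `ℤ`-independent family `a₁, …, a_ν ∈ ℤⁿ` and weights `Aⱼ > 0` the minors sum
`∑_t |det a_t| ∏_k A_{t k}` is positive (Cauchy–Binet: `det(a aᵀ) = ∑_t det(a_t)² ≠ 0`).
[folklore] -/
theorem sum_minors_pos {n ν : ℕ} (A : Fin n → ℝ) (hA : ∀ j, 0 < A j)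
    (a : Fin ν → (Fin n → ℤ)) (ha : LinearIndependent ℤ a) :
    0 < ∑ t ∈ (univ : Finset (Fin ν → Fin n)).filter (fun t => StrictMono t),
      |(Matrix.of fun i k => (a i (t k) : ℝ)).det| * ∏ k, A (t k) := by
  set aℝ : Matrix (Fin ν) (Fin n) ℝ := (Matrix.of a).map (Int.castRingHom ℝ) with haℝ
  have hGramℤ : (Matrix.of a * (Matrix.of a)ᵀ).det ≠ 0 :=
    det_mul_transpose_self_ne_zero (Matrix.of a) (by exact ha)
  have hGramℝ : (aℝ * aℝᵀ).det ≠ 0 := by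
    rw [haℝ, ← Matrix.transpose_map, ← Matrix.map_mul, det_map_castRingHom]
    exact_mod_cast hGramℤ
  have hsub : ∀ t : Fin ν → Fin n, aℝ.submatrix id t = Matrix.of fun i k => (a i (t k) : ℝ) :=
    fun t => by ext i k; simp [haℝ]
  have hterm_nonneg : ∀ t : Fin ν → Fin n,
      0 ≤ |(Matrix.of fun i k => (a i (t k) : ℝ)).det| * ∏ k, A (t k) := fun t =>
    mul_nonneg (abs_nonneg _) (Finset.prod_nonneg fun k _ => (hA _).le)
  by_contra hle
  rw [not_lt] at hle
  have hzero : ∀ t ∈ (univ : Finset (Fin ν → Fin n)).filter (fun t => StrictMono t),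
      |(Matrix.of fun i k => (a i (t k) : ℝ)).det| * ∏ k, A (t k) = 0 :=
    (Finset.sum_eq_zero_iff_of_nonneg fun t _ => hterm_nonneg t).mp
      (le_antisymm hle (Finset.sum_nonneg fun t _ => hterm_nonneg t))
  have hdet0 : ∀ t ∈ (univ : Finset (Fin ν → Fin n)).filter (fun t => StrictMono t),
      (Matrix.of fun i k => (a i (t k) : ℝ)).det = 0 := fun t ht => by
    have h := hzero t ht
    have hprod : 0 < ∏ k, A (t k) := Finset.prod_pos fun k _ => hA _
    rcases mul_eq_zero.mp h with h1 | h1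
    · exact abs_eq_zero.mp h1
    · exact absurd h1 hprod.ne'
  apply hGramℝ
  rw [Literature.Analysis.TotalPositivity.det_mul_eq_sum_strictMono]
  refine Finset.sum_eq_zero fun t ht => ?_
  rw [hsub, hdet0 t ht, zero_mul]

/-! ### The lever with the minors sum (what the induction consumes) -/

open scoped Classical in
/-- **The Matveev–Nesterenko lever against the minors sum** (Nesterenko 2003, Prop. 2.6 with
(5.19)–(5.21)): under the hypotheses of `exists_short_relation` — weights `Aⱼ > 0`, a `ℤ`-basis
`a₁, …, a_ν` of `Φ`, `k b ∈ Φ` with `k ≠ 0` — there are `ℤ`-independent `z₁, …, z_ν ∈ Φ`,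
`m₀ ≠ 0`, `m`, `J` (`#J = ν`) with `m₀ b = ∑ mᵢ zᵢ`,
`∏ᵢ ‖zᵢ‖_A ≤ 2^ν · (Γ(ν/2+1)/√π^ν) · √n^ν · ∑_t |det a_t| ∏_k A_{t k}`
(= (2.13) `Ω' ≤ 2^ν V(Φ)/V(𝔎)` combined with (5.21)
`V(Φ)/V(𝔎) ≤ Γ(1+ν/2) π^{−ν/2} n^{ν/2} ∑_I |det M_I| A_I`), and the Cramer–Hadamard bounds
(2.11) `|m₀| ∏_{j∈J} Aⱼ ≤ ∏ᵢ ‖zᵢ‖_A`, (2.12) `|mᵢ| ∏_{j∈J} Aⱼ ≤ (∑_{j∈J} |bⱼ|Aⱼ) ∏_{i'≠i} ‖z_{i'}‖_A`.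
[cite: Nesterenko2003, Prop 2.6 (2.9)–(2.13) pp. 57–58 and §5.2 (5.19)–(5.21) p. 103] -/
theorem exists_short_relation_minors {n ν : ℕ} (hν : 0 < ν) (A : Fin n → ℝ) (hA : ∀ j, 0 < A j)
    (a : Fin ν → (Fin n → ℤ)) (ha : LinearIndependent ℤ a)
    (b : Fin n → ℤ) (k : ℤ) (hk : k ≠ 0) (c : Fin ν → ℤ) (hb : k • b = ∑ i, c i • a i) :
    ∃ (z : Fin ν → (Fin n → ℤ)) (m₀ : ℤ) (m : Fin ν → ℤ) (J : Finset (Fin n)),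
      (∀ i, z i ∈ Submodule.span ℤ (Set.range a)) ∧
      LinearIndependent ℤ z ∧
      m₀ ≠ 0 ∧
      m₀ • b = ∑ i, m i • z i ∧
      J.card = ν ∧
      (∏ i, ∑ j, A j * |(z i j : ℝ)|) ≤
        2 ^ ν * (Real.Gamma ((ν : ℝ) / 2 + 1) / Real.sqrt Real.pi ^ ν) *
          (Real.sqrt n ^ ν *
            ∑ t ∈ (univ : Finset (Fin ν → Fin n)).filter (fun t => StrictMono t),
              |(Matrix.of fun i k => (a i (t k) : ℝ)).det| * ∏ k, A (t k)) ∧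
      |(m₀ : ℝ)| * ∏ j ∈ J, A j ≤ ∏ i, ∑ j, A j * |(z i j : ℝ)| ∧
      ∀ i, |(m i : ℝ)| * ∏ j ∈ J, A j ≤
        (∑ j ∈ J, |(b j : ℝ)| * A j) * ∏ i' ∈ univ.erase i, ∑ j, A j * |(z i' j : ℝ)| := by
  obtain ⟨z, m₀, m, J, hzΦ, hzli, hm₀, hrel, hJ, hStop, hreal, h211, h212⟩ :=
    exists_short_relation hν A hA a ha b k hk c hb
  have hvol := volume_weightedBall_ge hν A hA a ha
  have hMpos := sum_minors_pos A hA a ha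
  set M : ℝ := ∑ t ∈ (univ : Finset (Fin ν → Fin n)).filter (fun t => StrictMono t),
      |(Matrix.of fun i k => (a i (t k) : ℝ)).det| * ∏ k, A (t k) with hM
  set S : Set (Fin ν → ℝ) := {y : Fin ν → ℝ | ∑ j, A j * |∑ i, y i * (a i j : ℝ)| < 1} with hS
  set V : ℝ := (volume S).toReal with hV
  set P : ℝ := ∏ i, ∑ j, A j * |(z i j : ℝ)| with hP
  have hn : 0 < n := by
    rcases Nat.eq_zero_or_pos n with h0 | h0
    · subst h0
      exact absurd (funext fun j => Fin.elim0 j) (ha.ne_zero ⟨0, hν⟩)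
    · exact h0
  have hΓ : 0 < Real.Gamma ((ν : ℝ) / 2 + 1) := Real.Gamma_pos_of_pos (by positivity)
  have hsπ : 0 < Real.sqrt Real.pi ^ ν := pow_pos (Real.sqrt_pos.mpr Real.pi_pos) _
  have hsn : 0 < Real.sqrt n ^ ν := pow_pos (Real.sqrt_pos.mpr (by exact_mod_cast hn)) _
  set ω : ℝ := Real.sqrt Real.pi ^ ν / Real.Gamma ((ν : ℝ) / 2 + 1) with hω
  have hωpos : 0 < ω := div_pos hsπ hΓ
  have hden : 0 < Real.sqrt n ^ ν * M := mul_pos hsn hMpos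
  have hq : 0 < ω / (Real.sqrt n ^ ν * M) := div_pos hωpos hden
  have hVge : ω / (Real.sqrt n ^ ν * M) ≤ V := by
    rw [hV]
    exact (ENNReal.ofReal_le_iff_le_toReal hStop.ne).mp hvol
  have hVpos : 0 < V := lt_of_lt_of_le hq hVge
  have hPle : P ≤ 2 ^ ν / V := by
    rw [le_div_iff₀ hVpos]; exact hreal
  have hkey : P ≤ 2 ^ ν * (Real.Gamma ((ν : ℝ) / 2 + 1) / Real.sqrt Real.pi ^ ν) *
      (Real.sqrt n ^ ν * M) := by
    refine hPle.trans ?_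
    calc (2 : ℝ) ^ ν / V ≤ 2 ^ ν / (ω / (Real.sqrt n ^ ν * M)) :=
          div_le_div_of_nonneg_left (pow_nonneg zero_le_two _) hq hVge
      _ = 2 ^ ν * (Real.Gamma ((ν : ℝ) / 2 + 1) / Real.sqrt Real.pi ^ ν) *
          (Real.sqrt n ^ ν * M) := by
          rw [hω]
          field_simp
  exact ⟨z, m₀, m, J, hzΦ, hzli, hm₀, hrel, hJ, hkey, h211, h212⟩

end Summit.ABC.StewartYu.MatveevLever

end
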